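import Mathlib
import Summits.ValiantsHypothesis.ValiantsHypothesis.Theorems.GrenetZeonTwoDimCoefficientsDefs
import Summits.ValiantsHypothesis.ValiantsHypothesis.Theorems.GrenetZeonTwoDimCoefficientsDualUnipotentConstrainedPencil
import Summits.ValiantsHypothesis.ValiantsHypothesis.Theorems.GrenetZeonTwoDimCoefficientsDualUnipotentRankTransfer
import Summits.ValiantsHypothesis.ValiantsHypothesis.Theorems.GrenetZeonTwoDimCoefficientsDualUnipotentPowerTrace

/-!
# Crux `GrenetZeon.TwoDimCoefficients` (stmt-ValiantsHypothesis-8062), stub `stub_dualUnipotent`: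
# in power-trace currency the RANK OF THE CONSTANT WEIGHT is the interpolating parameter

`…DualUnipotentPowerTrace.lean` (p822914) states the stub's model as `per_n = tr(N(x)^n · E)` with
`N` a LINEAR nilpotent `m × m` pencil and `E` a CONSTANT weight (`tr(N^j·E) = 0` for `j ≠ n`), and
`…DualUnipotentConstDir.lean` (p822833) shows that the affine structure of the old direction `B`
is not an invariant.  What survives as an honest parameter is the RANK of the constant weight:
if `E = U₀·V` factors through `ℂ^r` (i.e. `rank E ≤ r`), then `tr(adj(1 − N)·N·E) =
Σ_{l ≤ r} v_lᵀ·adj(1 − N)·(N U₀)_l` is a sum of `r` bordered cofactor terms sharing the block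
`1 − N`, hence (tree: `hasDetRepr_of_dualUnipotentRepr_rank`, `r` diagonal copies of `1 − N` plus one
border) `per_n` is ONE affine determinant of size `m·r + 1`:

* `hasDetRepr_of_powerTrace_factor` — power trace of width `m` with weight `E = U₀·V` of inner
  dimension `r` ⟹ `HasDetRepr per_n (m·r + 1)` (so `dc(per_n) ≤ m·r + 1`);
* `sq_le_of_powerTrace_factor` — hence Mignon–Ressayre gives `n² ≤ 2(m·r + 1)` (`n ≥ 3`).

So `DualUnipotentBound` HOLDS on every sub-family of bounded weight rank (`C = 2r + 2`) — at
weight rank `r = 1` the permanent is a single bordered cofactor of a unipotent affine matrix, an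
honest determinant of size `m + 1` — while the forward normal form
`exists_powerTrace_of_dualUnipotentRepr` produces weights of rank exactly HALF THE WIDTH
(`E = [[0,0],[1,0]]` at width `2m`): the open content of the stub is precisely the regime
`rank E ≍ m`.

HONEST FRAMING: a re-location of the tree's rank interpolation (`sq_le_of_dualUnipotentRepr_rank`)
to the invariant parameter of the power-trace currency; constant-size bookkeeping; the stub stays
open; `VP ≠ VNP` is not moved by anything here.

References: T. Mignon, N. Ressayre, Int. Math. Res. Not. 2004:79, Thm. 1.1; L. G. Valiant,
Completeness classes in algebra, STOC 1979, §2.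
-/

-- single-conjunct layout `Summits/ValiantsHypothesis/ValiantsHypothesis`: the duplicated namespace
-- component is mandated by the tree.
set_option linter.dupNamespace false

noncomputable section

namespace Summit.ValiantsHypothesis.ValiantsHypothesis.Cruxes.TwoDimCoefficients.DimTwoCases

open MvPolynomial Matrix
open Literature.Computability.AlgebraicComplexity

variable {n m r : ℕ}

/-- Entries of `N · U₀` (`U₀` constant, rectangular) are affine when those of `N` are. [folklore] -/
theorem totalDegree_mul_map_C_le_one (N : AffMat n m) (hN : IsAffine N)
    (U₀ : Matrix (Fin m) (Fin r) ℂ) (i : Fin m) (k : Fin r) :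
    ((N * U₀.map (C : ℂ →+* MvPolynomial (Fin n × Fin n) ℂ)) i k).totalDegree ≤ 1 := by
  rw [Matrix.mul_apply]
  refine (totalDegree_finsetSum _ _).trans (Finset.sup_le fun l _ => ?_)
  rw [Matrix.map_apply]
  refine (totalDegree_mul _ _).trans ?_
  rw [totalDegree_C, add_zero]
  exact hN i l

/-- The power-trace data in unipotent-dual form with the factored direction `(N·U₀)·V`:
`per_n = 0·det(1 − N) + c⁻¹·tr(adj(1 − N)·(N·E))`, `E = U₀·V`. [folklore] -/
theorem dualForm_of_powerTrace_factor (hn : 1 ≤ n) (N : AffMat n m) (hnil : N ^ m = 0)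
    (U₀ : Matrix (Fin m) (Fin r) ℂ) (V : Matrix (Fin r) (Fin m) ℂ)
    (hper : perPoly (Fin n) ℂ = (N ^ n * (U₀ * V).map C).trace)
    (hcon : ∀ j : ℕ, j ≠ n → (N ^ j * (U₀ * V).map C).trace = 0) :
    ∃ c : ℂ, c ≠ 0 ∧ (1 - N).det = C c ∧
      (∀ i j, (N * (U₀ * V).map (C : ℂ →+* MvPolynomial (Fin n × Fin n) ℂ)) i j = ∑ k, (N * U₀.map (C : ℂ →+* MvPolynomial (Fin n × Fin n) ℂ)) i k * C (V k j)) ∧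
      perPoly (Fin n) ℂ = C 0 * (1 - N).det +
        C c⁻¹ * ((1 - N).adjugate * (N * (U₀ * V).map C)).trace := by
  obtain ⟨c, hc, hdet⟩ := exists_det_one_sub_eq_C N hnil
  have hM : perPoly (Fin n) ℂ = (N ^ (n - 1) * (N * (U₀ * V).map C)).trace := by
    rw [← Matrix.mul_assoc, ← pow_succ, Nat.sub_add_cancel hn]; exact hper
  have hconM : ∀ j < m, j ≠ n - 1 → (N ^ j * (N * (U₀ * V).map C)).trace = 0 := by
    intro j _ hj
    rw [← Matrix.mul_assoc, ← pow_succ]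
    exact hcon (j + 1) (by omega)
  refine ⟨c, hc, hdet, fun i j => ?_, ?_⟩
  · rw [Matrix.map_mul, ← Matrix.mul_assoc, Matrix.mul_apply]
    simp only [Matrix.map_apply]
  · rw [trace_adjugate_one_sub_mul N _ hnil, sum_trace_pow_mul_eq N _ hnil hconM, ← hM, hdet,
      map_zero, zero_mul, zero_add, ← mul_assoc, ← map_mul, inv_mul_cancel₀ hc, map_one, one_mul]

/-- **Weight of rank `≤ r` ⟹ an honest affine determinant of size `m·r + 1`.**  If
`per_n = tr(N^n · E)` (`n ≥ 1`) with `N` an affine `m × m` pencil, `N^m = 0`, a constant weight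
`E = U₀·V` factoring through `ℂ^r`, and `tr(N^j · E) = 0` for `j ≠ n`, then
`HasDetRepr per_n (m·r + 1)`. [folklore] -/
theorem hasDetRepr_of_powerTrace_factor (hn : 1 ≤ n) (N : AffMat n m) (hN : IsAffine N)
    (hnil : N ^ m = 0) (U₀ : Matrix (Fin m) (Fin r) ℂ) (V : Matrix (Fin r) (Fin m) ℂ)
    (hper : perPoly (Fin n) ℂ = (N ^ n * (U₀ * V).map C).trace)
    (hcon : ∀ j : ℕ, j ≠ n → (N ^ j * (U₀ * V).map C).trace = 0) :
    HasDetRepr (perPoly (Fin n) ℂ) (m * r + 1) := by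
  obtain ⟨c, hc, hdet, hB, h⟩ := dualForm_of_powerTrace_factor hn N hnil U₀ V hper hcon
  exact hasDetRepr_of_dualUnipotentRepr_rank hn 0 c⁻¹ c hc (1 - N) (N * (U₀ * V).map C)
    (N * U₀.map C) V (isAffine_one_sub N hN) (totalDegree_mul_map_C_le_one N hN U₀) hB hdet h

/-- **Weight of rank `≤ r` ⟹ `n² ≤ 2(m·r + 1)`** (`n ≥ 3`; Mignon–Ressayre on the determinant of
`hasDetRepr_of_powerTrace_factor`).  `DualUnipotentBound` therefore holds on every sub-family of
power-trace representations with bounded weight rank; the open regime is `rank E ≍ m`.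
[folklore] -/
theorem sq_le_of_powerTrace_factor (hn : 3 ≤ n) (N : AffMat n m) (hN : IsAffine N)
    (hnil : N ^ m = 0) (U₀ : Matrix (Fin m) (Fin r) ℂ) (V : Matrix (Fin r) (Fin m) ℂ)
    (hper : perPoly (Fin n) ℂ = (N ^ n * (U₀ * V).map C).trace)
    (hcon : ∀ j : ℕ, j ≠ n → (N ^ j * (U₀ * V).map C).trace = 0) :
    n ^ 2 ≤ 2 * (m * r + 1) := by
  obtain ⟨c, hc, hdet, hB, h⟩ := dualForm_of_powerTrace_factor (by omega) N hnil U₀ V hper hcon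
  exact sq_le_of_dualUnipotentRepr_rank hn 0 c⁻¹ c hc (1 - N) (N * (U₀ * V).map C)
    (N * U₀.map C) V (isAffine_one_sub N hN) (totalDegree_mul_map_C_le_one N hN U₀) hB hdet h

/-- **Rank-one weight.**  `per_n = tr(N^n · u·vᵀ)` (a SINGLE weighted entry of the power of a
nilpotent affine pencil of size `m`, other power traces vanishing) forces `n² ≤ 2(m + 1)`.
[folklore] -/
theorem sq_le_of_powerTrace_rankOne (hn : 3 ≤ n) (N : AffMat n m) (hN : IsAffine N)
    (hnil : N ^ m = 0) (u : Matrix (Fin m) (Fin 1) ℂ) (v : Matrix (Fin 1) (Fin m) ℂ)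
    (hper : perPoly (Fin n) ℂ = (N ^ n * (u * v).map C).trace)
    (hcon : ∀ j : ℕ, j ≠ n → (N ^ j * (u * v).map C).trace = 0) :
    n ^ 2 ≤ 2 * (m + 1) := by
  simpa using sq_le_of_powerTrace_factor hn N hN hnil u v hper hcon

end Summit.ValiantsHypothesis.ValiantsHypothesis.Cruxes.TwoDimCoefficients.DimTwoCases

end
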